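import Mathlib.Topology.GDelta.Basic
import Mathlib.Topology.Baire.Lemmas
import Mathlib.MeasureTheory.Measure.MeasureSpaceDef
import Mathlib.Analysis.InnerProductSpace.PiL2
import Literature.Geometry.Lorentzian.InitialData
import HarnessLib

-- provenance: harness21/H21/H21/Prelude/Lorentz/Genericity.lean @ a042e98 (interim HEAD d8f2665); M5 mechanical rewrite
/-!
# Genericity notions on spaces of initial data (trunk T-LORENTZ / G08, family `gr`)

The cosmic censorship conjectures (weak and strong) and the final state conjecture are
statements about *generic* asymptotically flat (or compact) initial data for the Einstein
equations. "Generic" has (at least) three inequivalent readings in the literature, and this file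
provides all three as parametrised predicates on an abstract data space `𝔻`, so that the target
statements can be stated for each:

* **topological** (Baire) genericity: the good set is residual (contains a dense `G_δ`), or the
  stronger *open-dense* genericity;
* **measure-theoretic** genericity: the good set has full measure for a chosen measure `μ`;
* **Christodoulou's finite-codimension** genericity (Christodoulou, *On the global initial value
  problem and the issue of singularities*, CQG **16** (1999) A23–A35, p. A24; *The instability of
  naked singularities in the gravitational collapse of a scalar field*, Ann. Math. **149** (1999)
  183–217, Thm. p. 187): the exceptional set `𝓔` has "codimension at least `m`" if through every
  exceptional datum there passes an `m`-parameter family of data meeting `𝓔` only at that datum.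
  We give this both for geometric data `InitialDataSet I X` (smooth families) and, in linear form
  `d + ∑ cᵢ fᵢ`, for function-space data (the spherically symmetric Einstein–scalar-field model
  of Ann. Math. 149, where the data are functions on a half-line and the families are affine
  2-planes).

For the *negation* of weak cosmic censorship one wants "a non-generic but non-negligible set of
counterexamples", rendered as `HasOpenSubset` (the exceptional set has nonempty interior).

## Main definitions (namespace `Literature.Lorentz`)

* `IsTopologicallyGeneric P`, `IsOpenDenseGeneric P`, `IsMeasureGeneric μ P`, `HasOpenSubset S`.
* `InitialDataSet.IsSmoothDataFamily m F`: `F : ℝᵐ → InitialDataSet I X` is jointly smooth.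
* `InitialDataSet.HasCodimAtLeast 𝓔 m`, `InitialDataSet.HasCodimAtLeastIn 𝓓 𝓔 m`,
  `InitialDataSet.IsChristodoulouGeneric 𝓓 P m`.
* `HasLinearCodimAtLeast 𝓓 𝓔 m` (linear families in a real vector space).

## Mathlib

`IsTopologicallyGeneric` and `IsMeasureGeneric` are *one-token wrappers* of Mathlib's `residual`
filter (`Mathlib.Topology.GDelta.Basic`, with `mem_residual` in `Mathlib.Topology.Baire.Lemmas`)
and of the almost-everywhere filter `MeasureTheory.ae` (`∀ᵐ d ∂μ, P d`); they exist only to give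
the target statements a uniform vocabulary (review F14). Mathlib has no notion of
finite-codimension exceptional sets (`rg -i "codim" Mathlib` finds only unrelated linear-algebra
lemmas).

## Design choices

* Christodoulou speaks of an "`m`-parameter family through `d`" without regularity or
  non-degeneracy conditions. The architect's regularisation: families are indexed by
  `EuclideanSpace ℝ (Fin m)`, pass through `d` at the parameter `0`, are **injective** (geometric
  version) resp. spanned by **linearly independent** directions (linear version), and are jointly
  smooth in (parameter, point) (geometric version). Without injectivity/independence the notion
  would be vacuous (constant families). This is flagged in each docstring.
* The relative version `HasCodimAtLeastIn 𝓓 𝓔 m` requires the family to stay inside the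
  admissible class `𝓓` (e.g. complete asymptotically flat vacuum data); `IsChristodoulouGeneric`
  is stated relative to `𝓓`.
* Smoothness of a family of data sets is smoothness of `(c, x) ↦ h_c(x)` and `(c, x) ↦ k_c(x)`
  as maps from the product manifold `ℝᵐ × X` into the total space of the bundle of bilinear
  forms on `TX`, verbatim as in `InitialDataSet.contMDiff_k`.
-/

open Manifold Bundle TopologicalSpace MeasureTheory
open scoped ContDiff Topology

noncomputable section

namespace Literature.Geometry.Lorentzian

/-! ### Abstract genericity notions on a data space `𝔻` -/

section Abstract

variable {𝔻 : Type*}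

/-- A property `P` of data is **topologically generic** (generic in the sense of Baire) if the
set `{d | P d}` is residual (in a Baire space: contains a dense `G_δ` subset of `𝔻`). This is a
thin wrapper of Mathlib's `residual 𝔻` filter: `IsTopologicallyGeneric P ↔ ∀ᶠ d in residual 𝔻,
P d` by `Iff.rfl`. Christodoulou, CQG 16 (1999) A23, p. A24 (discussion of genericity);
Ringström, *The Cauchy Problem in General Relativity* (2009), §17.2. [folklore] -/
def IsTopologicallyGeneric [TopologicalSpace 𝔻] (P : 𝔻 → Prop) : Prop :=
  {d | P d} ∈ residual 𝔻

/-- A property `P` of data is **open-dense generic** if `{d | P d}` contains an open dense subset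
of the data space `𝔻` (the strongest of the usual topological notions; it implies
`IsTopologicallyGeneric`). Ringström 2009, §17.2; Christodoulou, CQG 16 (1999) A23, p. A24. [cite: Ringstrom2009, §17.2] -/
def IsOpenDenseGeneric [TopologicalSpace 𝔻] (P : 𝔻 → Prop) : Prop :=
  ∃ U : Set 𝔻, IsOpen U ∧ Dense U ∧ U ⊆ {d | P d}

/-- A property `P` of data is **measure-theoretically generic** with respect to a measure `μ` on
the data space if it holds `μ`-almost everywhere. This is a thin wrapper of Mathlib's
almost-everywhere filter: `IsMeasureGeneric μ P ↔ ∀ᵐ d ∂μ, P d` by `Iff.rfl`.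
Christodoulou, CQG 16 (1999) A23, p. A24 ("exceptional set of measure zero"). [folklore] -/
def IsMeasureGeneric [MeasurableSpace 𝔻] (μ : Measure 𝔻) (P : 𝔻 → Prop) : Prop :=
  ∀ᵐ d ∂μ, P d

/-- A set `S` of data **has an open subset**: its interior is nonempty. Used to phrase the
negation of weak cosmic censorship ("naked singularities form from an open set of data").
Christodoulou, CQG 16 (1999) A23, p. A24; Wald, *Gravitational collapse and cosmic censorship*
(1997), §2. [folklore] -/
def HasOpenSubset [TopologicalSpace 𝔻] (S : Set 𝔻) : Prop :=
  (interior S).Nonempty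

variable [TopologicalSpace 𝔻]

/-- Unfolding lemma: topological genericity is eventual truth along the residual filter. [folklore] -/
lemma isTopologicallyGeneric_iff_eventually (P : 𝔻 → Prop) :
    IsTopologicallyGeneric P ↔ ∀ᶠ d in residual 𝔻, P d := Iff.rfl

/-- In a Baire space, topological genericity means `{d | P d}` contains a dense `G_δ` set
(`mem_residual`). [folklore] -/
lemma isTopologicallyGeneric_iff_exists_isGδ [BaireSpace 𝔻] (P : 𝔻 → Prop) :
    IsTopologicallyGeneric P ↔ ∃ t ⊆ {d | P d}, IsGδ t ∧ Dense t :=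
  mem_residual

/-- Open-dense genericity implies topological genericity (`residual_of_dense_open`). [folklore] -/
lemma IsOpenDenseGeneric.isTopologicallyGeneric {P : 𝔻 → Prop} (hP : IsOpenDenseGeneric P) :
    IsTopologicallyGeneric P := by
  obtain ⟨U, hUo, hUd, hUP⟩ := hP
  exact Filter.mem_of_superset (residual_of_dense_open hUo hUd) hUP

/-- In a Baire space a topologically generic property holds on a dense set
(`dense_of_mem_residual`). [folklore] -/
lemma IsTopologicallyGeneric.dense [BaireSpace 𝔻] {P : 𝔻 → Prop}
    (hP : IsTopologicallyGeneric P) : Dense {d | P d} :=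
  dense_of_mem_residual hP

/-- In a nonempty Baire space, a topologically generic property and a property holding on a set
with nonempty interior are compatible: some datum satisfies both. In particular the exceptional
set of a topologically generic property has no open subset. Consequence of
`dense_of_mem_residual` and `Dense.inter_open_nonempty`. [folklore] -/
lemma IsTopologicallyGeneric.not_hasOpenSubset_compl [BaireSpace 𝔻] {P : 𝔻 → Prop}
    (hP : IsTopologicallyGeneric P) : ¬ HasOpenSubset {d | ¬ P d} := by
  rintro ⟨d, hd⟩
  obtain ⟨x, hxi, hxP⟩ :=
    hP.dense.inter_open_nonempty (interior {d | ¬ P d}) isOpen_interior ⟨d, hd⟩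
  exact interior_subset hxi hxP

end Abstract

section Measure

variable {𝔻 : Type*} [MeasurableSpace 𝔻]

/-- Unfolding lemma: measure genericity is `∀ᵐ`. [folklore] -/
lemma isMeasureGeneric_iff (μ : Measure 𝔻) (P : 𝔻 → Prop) :
    IsMeasureGeneric μ P ↔ ∀ᵐ d ∂μ, P d := Iff.rfl

/-- Measure genericity means the exceptional set is `μ`-null (`MeasureTheory.ae_iff`). [folklore] -/
lemma isMeasureGeneric_iff_measure_compl_eq_zero (μ : Measure 𝔻) (P : 𝔻 → Prop) :
    IsMeasureGeneric μ P ↔ μ {d | ¬ P d} = 0 := ae_iff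

end Measure

/-! ### Christodoulou's finite-codimension genericity for geometric initial data -/

namespace InitialDataSet

variable {E : Type*} [NormedAddCommGroup E] [NormedSpace ℝ E] {H : Type*} [TopologicalSpace H]
  {I : ModelWithCorners ℝ E H} {X : Type*} [TopologicalSpace X] [ChartedSpace H X]
  [IsManifold I ∞ X]

/-- A map `F : ℝᵐ → InitialDataSet I X` (parameters in `EuclideanSpace ℝ (Fin m)`) is a
**smooth `m`-parameter family of initial data** if both `(c, x) ↦ h_c(x)` and `(c, x) ↦ k_c(x)`
are `C^∞` maps from the product manifold `ℝᵐ × X` to the total space of the bundle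
`Hom(TX, Hom(TX, ℝ))` of bilinear forms on `TX` (compare `InitialDataSet.contMDiff_k`, the case
`m = 0`). This is the architect's regularisation of Christodoulou's "`m`-parameter family of
initial data" (CQG 16 (1999) A23, p. A24; Ann. Math. 149 (1999) 183, p. 187), which imposes no
explicit regularity in the parameter. [folklore] -/
def IsSmoothDataFamily (m : ℕ) (F : EuclideanSpace ℝ (Fin m) → InitialDataSet I X) : Prop :=
  ContMDiff (𝓘(ℝ, EuclideanSpace ℝ (Fin m)).prod I) (I.prod 𝓘(ℝ, E →L[ℝ] E →L[ℝ] ℝ)) ∞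
      (fun p : EuclideanSpace ℝ (Fin m) × X ↦
        TotalSpace.mk' (F := E →L[ℝ] E →L[ℝ] ℝ)
          (E := fun x : X ↦ TangentSpace I x →L[ℝ] TangentSpace I x →L[ℝ] ℝ) p.2
          ((F p.1).h.inner p.2)) ∧
    ContMDiff (𝓘(ℝ, EuclideanSpace ℝ (Fin m)).prod I) (I.prod 𝓘(ℝ, E →L[ℝ] E →L[ℝ] ℝ)) ∞
      (fun p : EuclideanSpace ℝ (Fin m) × X ↦
        TotalSpace.mk' (F := E →L[ℝ] E →L[ℝ] ℝ)
          (E := fun x : X ↦ TangentSpace I x →L[ℝ] TangentSpace I x →L[ℝ] ℝ) p.2 ((F p.1).k p.2))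

/-- A constant family is a smooth `m`-parameter family for every `m` (smoothness in `x` is
`h.contMDiff` and `contMDiff_k`, composed with the projection `ℝᵐ × X → X`). [folklore] -/
lemma isSmoothDataFamily_const (m : ℕ) (d : InitialDataSet I X) :
    IsSmoothDataFamily m (fun _ : EuclideanSpace ℝ (Fin m) ↦ d) :=
  ⟨d.h.contMDiff.comp contMDiff_snd, d.contMDiff_k.comp contMDiff_snd⟩

/-- **Christodoulou's finite codimension** (absolute version). A set `𝓔` of initial data sets on
`X` **has codimension at least `m`** if through every `d ∈ 𝓔` there passes a smooth injective
`m`-parameter family `F : ℝᵐ → InitialDataSet I X` with `F 0 = d` which meets `𝓔` only at the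
parameter `0`. Injectivity is the architect's regularisation of "`m`-parameter family" (without
it, constant families would make every set have every codimension). Christodoulou, CQG 16 (1999)
A23–A35, p. A24; Ann. Math. 149 (1999) 183–217, p. 187. [folklore] -/
def HasCodimAtLeast (𝓔 : Set (InitialDataSet I X)) (m : ℕ) : Prop :=
  ∀ d ∈ 𝓔, ∃ F : EuclideanSpace ℝ (Fin m) → InitialDataSet I X,
    IsSmoothDataFamily m F ∧ F 0 = d ∧ Function.Injective F ∧ ∀ c ≠ 0, F c ∉ 𝓔

/-- **Christodoulou's finite codimension** (relative version). A set `𝓔` of initial data sets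
**has codimension at least `m` inside the admissible class `𝓓`** (e.g. complete asymptotically
flat solutions of the vacuum constraints) if for every `d ∈ 𝓔` there is a smooth injective `m`-parameter family `F` of data *in `𝓓`* with `F 0 = d`
meeting `𝓔` only at the parameter `0`. (In particular `𝓔 ⊆ 𝓓` is forced.) Injectivity is the
architect's regularisation. Christodoulou, CQG 16 (1999) A23–A35, p. A24; Ann. Math. 149 (1999)
183–217, p. 187. [folklore] -/
def HasCodimAtLeastIn (𝓓 𝓔 : Set (InitialDataSet I X)) (m : ℕ) : Prop :=
  ∀ d ∈ 𝓔, ∃ F : EuclideanSpace ℝ (Fin m) → InitialDataSet I X,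
    IsSmoothDataFamily m F ∧ F 0 = d ∧ Function.Injective F ∧ (∀ c, F c ∈ 𝓓) ∧
      ∀ c ≠ 0, F c ∉ 𝓔

/-- A property `P` of admissible data (`𝓓` the admissible class) is **generic in the sense of
Christodoulou with codimension `m`** if its exceptional set `{d ∈ 𝓓 | ¬ P d}` has codimension
at least `m` inside `𝓓`. Christodoulou's formulation of cosmic censorship asks for `m = 1`
("the exceptional set has positive codimension"). Christodoulou, CQG 16 (1999) A23–A35, p. A24;
Ann. Math. 149 (1999) 183–217, p. 187. [folklore] -/
def IsChristodoulouGeneric (𝓓 : Set (InitialDataSet I X)) (P : InitialDataSet I X → Prop)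
    (m : ℕ) : Prop :=
  HasCodimAtLeastIn 𝓓 {d ∈ 𝓓 | ¬ P d} m

/-- The relative notion implies the absolute one (forget the admissibility of the family). [folklore] -/
lemma HasCodimAtLeastIn.hasCodimAtLeast {𝓓 𝓔 : Set (InitialDataSet I X)} {m : ℕ}
    (h : HasCodimAtLeastIn 𝓓 𝓔 m) : HasCodimAtLeast 𝓔 m := by
  intro d hd
  obtain ⟨F, hF, h0, hinj, -, hE⟩ := h d hd
  exact ⟨F, hF, h0, hinj, hE⟩

/-- An exceptional set of positive relative codimension lies in the admissible class (evaluate the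
family at the parameter `0`). [folklore] -/
lemma HasCodimAtLeastIn.subset {𝓓 𝓔 : Set (InitialDataSet I X)} {m : ℕ}
    (h : HasCodimAtLeastIn 𝓓 𝓔 m) : 𝓔 ⊆ 𝓓 := by
  intro d hd
  obtain ⟨F, -, h0, -, hD, -⟩ := h d hd
  exact h0 ▸ hD 0

/-- Every set has codimension at least `0` (the `0`-parameter family through `d` is `{d}`). [folklore] -/
lemma hasCodimAtLeast_zero (𝓔 : Set (InitialDataSet I X)) : HasCodimAtLeast 𝓔 0 := by
  intro d hd
  refine ⟨fun _ ↦ d, isSmoothDataFamily_const 0 d, rfl, ?_, ?_⟩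
  · intro a b _
    exact Subsingleton.elim a b
  · intro c hc
    exact absurd (Subsingleton.elim c 0) hc

/-- The empty exceptional set has every codimension: a property that holds for all admissible
data is Christodoulou-generic for every `m`. [folklore] -/
lemma isChristodoulouGeneric_of_forall {𝓓 : Set (InitialDataSet I X)}
    {P : InitialDataSet I X → Prop} (hP : ∀ d ∈ 𝓓, P d) (m : ℕ) :
    IsChristodoulouGeneric 𝓓 P m := by
  intro d hd
  exact absurd (hP d hd.1) hd.2

/-- Relative finite codimension is **antitone in the exceptional set**: a subset of a set of
codimension at least `m` inside `𝓓` has codimension at least `m` inside `𝓓` (the same families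
avoid the smaller set off the parameter `0`). Christodoulou, CQG 16 (1999) A23–A35, p. A24. [folklore] -/
lemma HasCodimAtLeastIn.anti {𝓓 𝓔 𝓔' : Set (InitialDataSet I X)} {m : ℕ}
    (h : HasCodimAtLeastIn 𝓓 𝓔 m) (h' : 𝓔' ⊆ 𝓔) : HasCodimAtLeastIn 𝓓 𝓔' m := by
  intro d hd
  obtain ⟨F, hF, h0, hinj, hD, hE⟩ := h d (h' hd)
  exact ⟨F, hF, h0, hinj, hD, fun c hc hc' ↦ hE c hc (h' hc')⟩

/-- **Christodoulou genericity is monotone under pointwise implication on the admissible class**: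
if `P` is generic with codimension `m` in `𝓓` and `P d → Q d` for every `d ∈ 𝓓`, then so is `Q`
(the exceptional set of `Q` lies in that of `P`). This is the step by which every route assembly of
the final state conjecture passes from one generic statement to a weaker one. Christodoulou, CQG 16
(1999) A23–A35, p. A24. [folklore] -/
lemma IsChristodoulouGeneric.mono {𝓓 : Set (InitialDataSet I X)} {P Q : InitialDataSet I X → Prop}
    {m : ℕ} (h : IsChristodoulouGeneric 𝓓 P m) (hPQ : ∀ d ∈ 𝓓, P d → Q d) :
    IsChristodoulouGeneric 𝓓 Q m :=
  HasCodimAtLeastIn.anti h fun _ hd ↦ ⟨hd.1, fun hP ↦ hd.2 (hPQ _ hd.1 hP)⟩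

/-- Christodoulou genericity of a conjunction gives genericity of each conjunct (left). [folklore] -/
lemma IsChristodoulouGeneric.and_left {𝓓 : Set (InitialDataSet I X)}
    {P Q : InitialDataSet I X → Prop} {m : ℕ} (h : IsChristodoulouGeneric 𝓓 (fun d ↦ P d ∧ Q d) m) :
    IsChristodoulouGeneric 𝓓 P m :=
  h.mono fun _ _ hd ↦ hd.1

/-- Christodoulou genericity of a conjunction gives genericity of each conjunct (right). [folklore] -/
lemma IsChristodoulouGeneric.and_right {𝓓 : Set (InitialDataSet I X)}
    {P Q : InitialDataSet I X → Prop} {m : ℕ} (h : IsChristodoulouGeneric 𝓓 (fun d ↦ P d ∧ Q d) m) :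
    IsChristodoulouGeneric 𝓓 Q m :=
  h.mono fun _ _ hd ↦ hd.2

end InitialDataSet

/-! ### Linear finite-codimension genericity for function-space data -/

section Linear

variable {V : Type*} [AddCommGroup V] [Module ℝ V]

/-- **Christodoulou's finite codimension, linear form.** For data in a real vector space `V` of
functions (e.g. the space of spherically symmetric scalar-field data `α = ∂_r(rφ)` on a half-line
of Ann. Math. 149), an exceptional set `𝓔` **has linear codimension at least `m` inside the
admissible class `𝓓`** if for every `d ∈ 𝓔` there are `m` linearly independent directions
`f₁, …, fₘ` such that the affine family `d + ∑ cᵢ fᵢ` stays in `𝓓` and meets `𝓔` only at `c = 0`.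
Christodoulou's instability theorem is the case `m = 2` ("the family `α₀ + λ₁ f₁ + λ₂ f₂`").
Linear independence is the architect's regularisation of "2-parameter family". Christodoulou,
Ann. Math. 149 (1999) 183–217, Thm. p. 187; CQG 16 (1999) A23–A35, p. A24. [folklore] -/
def HasLinearCodimAtLeast (𝓓 𝓔 : Set V) (m : ℕ) : Prop :=
  ∀ d ∈ 𝓔, ∃ f : Fin m → V, LinearIndependent ℝ f ∧ (∀ c : Fin m → ℝ, d + ∑ i, c i • f i ∈ 𝓓) ∧
    ∀ c : Fin m → ℝ, c ≠ 0 → d + ∑ i, c i • f i ∉ 𝓔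

/-- An exceptional set of linear codimension at least `m` inside `𝓓` lies in `𝓓` (take `c = 0`). [folklore] -/
lemma HasLinearCodimAtLeast.subset {𝓓 𝓔 : Set V} {m : ℕ} (h : HasLinearCodimAtLeast 𝓓 𝓔 m) :
    𝓔 ⊆ 𝓓 := by
  intro d hd
  obtain ⟨f, -, hD, -⟩ := h d hd
  simpa using hD 0

/-- Linear codimension is monotone in `m`: dropping directions of a family keeps its properties.
An elementary property of the definition `HasLinearCodimAtLeast` (no single source); DISCHARGED
in the tree by `HasLinearCodimAtLeast.mono_holds`
(`Literature/Geometry/Lorentzian/GenericityFacts.lean`). [folklore] -/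
def HasLinearCodimAtLeast.mono : Prop :=
  ∀ {𝓓 𝓔 : Set V} {m n : ℕ} (hmn : m ≤ n) (h : HasLinearCodimAtLeast 𝓓 𝓔 n),
    HasLinearCodimAtLeast 𝓓 𝓔 m

end Linear

end Literature.Geometry.Lorentzian

end
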